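import Mathlib
import Literature.MathematicalPhysics.QuantumFieldTheory.Luscher2010.TrivializingMaps
import Literature.MathematicalPhysics.QuantumFieldTheory.Luscher2010.FlowActionSeries
import Summits.Ventures.LatticeQCDFlow.TrivializingMaps.UniformRadius
import HarnessLib

/-!
# Truncated trivializing flows: the exact defect identity, its extensivity, acceptance floors,
# and the quantitative form of Lüscher's convergence question  (venture side — OUR statements)

HONEST FRAMING: exact (Metropolis-corrected) sampling algorithms for lattice gauge theory; figures
of merit are autocorrelation/cost numbers at stated couplings and volumes; no continuum-physics claim.

Proposed tree file: `Summits/Ventures/LatticeQCDFlow/TrivializingMaps/Truncation.lean`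
(namespace `Summit.Ventures.LatticeQCDFlow.TrivializingMaps`). Nothing here is a Literature fact:
§1 and §5 are PROVED lemmas of ours, §2–§4 are typed prover targets (ours, derived from Lüscher's
(3.9), (4.3), (4.12)–(4.13) and §4.5(c)), §6 is a CONJECTURE item sharpening `LuscherUniformRadius`.

The chain of statements (the "provable locality / volume-scaling theory of the ANALYTIC map"):
* §1 `luscherOp_truncSeries` (PROVED, formal): for any Lüscher series, Lüscher's operator applied to the
  order-`N` partial sum leaves the EXACT defect `t^{N+1} 𝓥 S̃^{(N)}`:
  `𝓛_t S̃^{[N]}_t = S + ∑_{k≤N} t^k Ċ^{(k)} + t^{N+1} 𝓥 S̃^{(N)}`, `𝓥 = ∑ (∂^a S) ∂^a`.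
* §2 the same identity for `luscherL` on the field manifold (target; needs additivity of `linkDeriv` on
  smooth functions).
* §3 consequence for the order-`N` truncated flow map `Φ₁` (target; uses the cited Jacobian formula
  (3.9)): the model law `q = (Φ₁)_* D[V]` has a density `ρ` against the target `𝒵⁻¹e^{-S}D[U]` with
  `log`-oscillation `≤ 2K/(N+2)`, `K = sup_U |𝓥 S̃^{(N)}(U)|`; and its general form
  `DefectControlsLogWeight`: for ANY smooth flow-action family (e.g. learned loop coefficients) the sup of
  the defect of the flow equation (4.5) bounds the log-weight oscillation (by `2δ`).
* §4 extensivity (target): for the Wilson action `K ≤ b_N · |E|` with `b_N` INDEPENDENT of `L`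
  (finite-order locality + volume-independent coefficients), and by `IsLuscherSeries.smul` the coupling
  enters as `β^{N+2}` (flow time `t` as `t^{N+2}`): the expansion parameter is `tβ`.
* §5 (PROVED, finite models): `log`-oscillation `≤ K'` of `p/q` forces mean IMH acceptance `≥ e^{-K'}`
  and ESS fraction `≥ e^{-K'}` — so §3–§4 give the EXPLICIT volume law
  `acceptance ≥ exp(-2 β^{N+2} b_N |E| / (N+2))` for the order-`N` analytic map (a floor; the matching
  ceiling for fixed `N` is theory-2's product law / barrier B1).
* §6 `LuscherGeometricGradientBound` (CONJECTURE): `|∂ s_k| ≤ C ρ^{-k}` uniformly in `L`; PROVED to imply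
  `LuscherUniformRadius d n 1` (radius `≥ ρ`); with §3–§5 it says: for `tβ < ρ` an order
  `N ≍ log|E| / log(ρ/(tβ))` suffices for `O(1)` acceptance — logarithmic depth, footprint `∝ log V` —,
  while for `tβ ≥ ρ` no order helps. Deciding number for the cell: `ρ` (2-d U(1): exact low orders in
  THEORY-1.md §10; 4-d SU(3): unknown).
-/

namespace Summit.Ventures.LatticeQCDFlow.TrivializingMaps

open MeasureTheory
open Literature.MathematicalPhysics.QuantumFieldTheory
open Literature.MathematicalPhysics.QuantumFieldTheory.Luscher2010
open scoped Matrix Matrix.Norms.Frobenius ENNReal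

/-- Local notation for `SU(n) ⊆ M_n(ℂ)`, as in `WilsonFlow.lean`. -/
local notation "SU[" n "]" => Matrix.specialUnitaryGroup (Fin n) ℂ

noncomputable section

/-! ## §1. The defect identity of the order-`N` truncation — formal version (PROVED) -/

section Formal

variable {M : Type*} [AddCommGroup M] [Module ℝ M]

/-- Partial sums `S̃^{[N]}_t = ∑_{k ≤ N} t^k S̃^{(k)}` of a series with coefficients in a real vector space
(the flow action truncated at order `N`, Lüscher §4.5(c)). [folklore] -/
def truncSeries (Sk : ℕ → M) (t : ℝ) (N : ℕ) : M := ∑ k ∈ Finset.range (N + 1), t ^ k • Sk k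

/-- The order-`0` truncation is the order-`0` coefficient. -/
theorem truncSeries_zero (Sk : ℕ → M) (t : ℝ) : truncSeries Sk t 0 = Sk 0 := by
  simp [truncSeries]

/-- Truncating at order `N+1` adds the term `t^{N+1} • Sk (N+1)`. -/
theorem truncSeries_succ (Sk : ℕ → M) (t : ℝ) (N : ℕ) :
    truncSeries Sk t (N + 1) = truncSeries Sk t N + t ^ (N + 1) • Sk (N + 1) := by
  simp [truncSeries, Finset.sum_range_succ]

/-- **Exact defect of the truncated Lüscher series (formal).** If `Δ S̃^{(0)} = S + Ċ^{(0)}·1` and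
`Δ S̃^{(k+1)} = -𝓥 S̃^{(k)} + Ċ^{(k+1)}·1` for linear operators `Δ, 𝓥` (Lüscher's recursion (4.12)–(4.13) with
`𝓥 = ∑ (∂^a S) ∂^a`, so that `𝓛_t = Δ + t 𝓥`), then for every `t` and `N`
`(Δ + t𝓥) S̃^{[N]}_t = S + (∑_{k≤N} t^k Ċ^{(k)})·1 + t^{N+1} 𝓥 S̃^{(N)}`:
the truncation satisfies the trivializing-flow equation (4.5) EXACTLY up to the single term
`t^{N+1} 𝓥 S̃^{(N)}` — Lüscher's "additive correction of order `t^{n+1}`" (§4.5(c)) in closed form.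
PROVED (induction on `N`, telescoping). [folklore] -/
theorem luscherOp_truncSeries (Δ V : M →ₗ[ℝ] M) (S one : M) (Sk : ℕ → M) (c : ℕ → ℝ)
    (h0 : Δ (Sk 0) = S + c 0 • one) (hk : ∀ k, Δ (Sk (k + 1)) = -V (Sk k) + c (k + 1) • one)
    (t : ℝ) (N : ℕ) :
    Δ (truncSeries Sk t N) + t • V (truncSeries Sk t N) =
      S + (∑ k ∈ Finset.range (N + 1), t ^ k * c k) • one + t ^ (N + 1) • V (Sk N) := by
  induction N with
  | zero =>
    rw [truncSeries_zero, h0, Finset.sum_range_one, pow_zero, one_mul, zero_add, pow_one]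
  | succ N ih =>
    rw [truncSeries_succ, map_add, map_add, map_smul, map_smul, Finset.sum_range_succ, hk N]
    have e1 : Δ (truncSeries Sk t N) + t ^ (N + 1) • (-V (Sk N) + c (N + 1) • one) +
        t • (V (truncSeries Sk t N) + t ^ (N + 1) • V (Sk (N + 1))) =
        (Δ (truncSeries Sk t N) + t • V (truncSeries Sk t N)) - t ^ (N + 1) • V (Sk N) +
          (t ^ (N + 1) * c (N + 1)) • one + t ^ (N + 1 + 1) • V (Sk (N + 1)) := by
      simp only [smul_add, smul_neg, smul_smul]
      rw [show t * t ^ (N + 1) = t ^ (N + 1 + 1) from (pow_succ' t (N + 1)).symm]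
      abel
    rw [e1, ih, add_smul]
    abel

end Formal

/-! ## §2. The identity for Lüscher's operator `𝓛_t` on the field manifold (typed target) -/

variable {d L n : ℕ}

/-- The first-order part `𝓥 f = ∑_{x,μ,a} (∂^a_{x,μ} S)(∂^a_{x,μ} f)` of Lüscher's operator, so that
`𝓛_t = Δ + t 𝓥` (eq. (4.6)); `-𝓥` is the drift part of the Langevin generator of `e^{-S} D[U]`.
[cite: Luscher2010Trivializing, §4.2 eq. (4.6)] -/
def luscherV [NeZero L] (B : SuBasis n) (S f : AmbConfig d L n → ℝ) (W : AmbConfig d L n) : ℝ :=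
  ∑ e : Edge d L, ∑ a : B.ι, linkDeriv e (B.T a) S W * linkDeriv e (B.T a) f W

/-- Lüscher's operator unfolded: `𝓛_t f = Δ f + t · 𝓥_S f` with `𝓥_S f = ∑ ∂S·∂f` (`luscherV`). -/
theorem luscherL_eq [NeZero L] (B : SuBasis n) (S : AmbConfig d L n → ℝ) (t : ℝ)
    (φ : AmbConfig d L n → ℝ) (W : AmbConfig d L n) :
    luscherL B S t φ W = linkLap B φ W + t * luscherV B S φ W := rfl

/-- The order-`N` truncated flow action `S̃^{[N]}_t(W) = ∑_{k≤N} t^k S̃^{(k)}(W)` as a field functional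
(`= truncSeries Sk t N` in the function space). [cite: Luscher2010Trivializing, §4.5(c)] -/
def truncFlowAction (Sk : ℕ → AmbConfig d L n → ℝ) (t : ℝ) (N : ℕ) : AmbConfig d L n → ℝ :=
  fun W => ∑ k ∈ Finset.range (N + 1), t ^ k * Sk k W

/-- **Exact defect identity on the field manifold** (OURS, typed target, M-sized): for a smooth action and a
smooth Lüscher series, `𝓛_t S̃^{[N]}_t = S + ∑_{k≤N} t^k Ċ^{(k)} + t^{N+1} 𝓥 S̃^{(N)}` pointwise on `SU(n)^E`.
Proof route: `luscherOp_truncSeries` (§1) in the vector space of smooth field functionals, where `linkLap B`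
and `luscherV B S` ARE linear (`deriv_add`/`deriv_const_mul` need the differentiability supplied by
`ContDiff`); the only work is the additivity lemma `linkDeriv e X (f + g) = linkDeriv e X f + linkDeriv e X g`
for `C¹` functions along the smooth link curves `s ↦ e^{sX} W(e)`. [folklore] -/
def TruncationDefectIdentity (d L n : ℕ) : Prop :=
  ∀ [NeZero L] (B : SuBasis n) (S : AmbConfig d L n → ℝ) (Sk : ℕ → AmbConfig d L n → ℝ) (c : ℕ → ℝ),
    ContDiff ℝ (⊤ : ℕ∞) S → (∀ k, ContDiff ℝ (⊤ : ℕ∞) (Sk k)) → IsLuscherSeries B S Sk c →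
    ∀ (t : ℝ) (N : ℕ) (U : GaugeConfig d L SU[n]),
      luscherL B S t (truncFlowAction Sk t N) (WilsonFlow.coeConfig U) =
        S (WilsonFlow.coeConfig U) + (∑ k ∈ Finset.range (N + 1), t ^ k * c k) +
          t ^ (N + 1) * luscherV B S (Sk N) (WilsonFlow.coeConfig U)

/-! ## §3. The order-`N` truncated flow MAP: log-weight oscillation (typed target) -/

/-- **Log-weight bound for the truncated trivializing map** (OURS, typed target, L-sized; Lüscher §4.5(c)
made quantitative). Let `Φ` be the (measurable) integrated transformation of the truncated gradient
generator `Z_t = -∂ S̃^{[N]}_t` and `K = sup_{U ∈ SU(n)^E} |𝓥 S̃^{(N)}(U)|`. Then the model law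
`q = (Φ₁)_* D[V]` is the target `𝒵⁻¹ e^{-S} D[U]` reweighted by a positive density `ρ` whose logarithm
oscillates by at most `2K/(N+2)`. Derivation: by (3.2), (3.9) and the defect identity,
`d/dt [ln det Φ_{t*}(V) - t S(Φ_t V)] = Ċ_t + t^{N+1} (𝓥 S̃^{(N)})(Φ_t V)`, so
`S(Φ₁V) - ln det Φ_{1*}(V) = const - R(V)`, `R(V) = ∫₀¹ t^{N+1} (𝓥 S̃^{(N)})(Φ_tV) dt`, `|R| ≤ K/(N+2)`, and
`ρ(Φ₁ V) = 𝒵 e^{const - R(V)}`. Inputs: `JacobianFormula` (cited, (3.9)), `TruncationDefectIdentity` (§2),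
FTC along flow lines. [cite: Luscher2010Trivializing, §3.2 eq. (3.9), §4.1 eqs. (4.1)–(4.3), §4.5(c)] -/
def TruncatedMapLogWeightBound (d L n : ℕ) : Prop :=
  ∀ [NeZero L] (B : SuBasis n) (S : AmbConfig d L n → ℝ) (Sk : ℕ → AmbConfig d L n → ℝ) (c : ℕ → ℝ)
    (N : ℕ) (Φ : ℝ → GaugeConfig d L SU[n] → GaugeConfig d L SU[n]) (K : ℝ),
    ContDiff ℝ (⊤ : ℕ∞) S → (∀ k, ContDiff ℝ (⊤ : ℕ∞) (Sk k)) → IsLuscherSeries B S Sk c →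
    IsFlowMap (fun t W => -linkGrad B (truncFlowAction Sk t N) W) Φ → (∀ t, Measurable (Φ t)) →
    (∀ U : GaugeConfig d L SU[n], |luscherV B S (Sk N) (WilsonFlow.coeConfig U)| ≤ K) →
    ∃ ρ : GaugeConfig d L SU[n] → ℝ, Measurable ρ ∧ (∀ U, 0 < ρ U) ∧
      Measure.map (Φ 1) (trivialMeasure SU[n] d L) =
        (boltzmannMeasure fun U : GaugeConfig d L SU[n] => S (WilsonFlow.coeConfig U)).withDensity
          (fun U => ENNReal.ofReal (ρ U)) ∧
      ∀ U U', ρ U ≤ Real.exp (2 * K / (N + 2)) * ρ U'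

/-- **The flow-equation defect controls the log-weight** (OURS, typed target, L-sized; Lüscher's (4.3)
rearranged — the GENERAL form of `TruncatedMapLogWeightBound`, valid for ANY smooth family of flow actions
`S̃_t`, in particular truncated loop expansions with LEARNED coefficients). If `Φ` integrates `Z_t = -∂S̃_t`
and the defect `D_t(U) = (𝓛_t S̃_t)(U) - S(U) - Ċ_t` of the trivializing-flow equation (4.5) satisfies
`|D_t(U)| ≤ δ` on `[0,1] × SU(n)^E` (for SOME function `Ċ`), then, by (3.9),
`d/dt [t S(Φ_tV) - ln det Φ_{t*}(V)] = -Ċ_t - D_t(Φ_tV)`, so the pulled-back action is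
`const - ∫₀¹ D_t(Φ_tV) dt` and the model law `(Φ₁)_* D[V]` is the target reweighted by a positive density
whose logarithm oscillates by at most `2δ` (§5 then gives acceptance and ESS `≥ e^{-2δ}`). The sup-norm of
the defect is thus a provable surrogate objective; its `β`- and volume-dependence for fixed loop bases is
§4. [cite: Luscher2010Trivializing, §3.2 eq. (3.9), §4.1 eqs. (4.1)–(4.5)] -/
def DefectControlsLogWeight (d L n : ℕ) : Prop :=
  ∀ [NeZero L] (B : SuBasis n) (S : AmbConfig d L n → ℝ) (St : ℝ → AmbConfig d L n → ℝ) (c : ℝ → ℝ)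
    (Φ : ℝ → GaugeConfig d L SU[n] → GaugeConfig d L SU[n]) (δ : ℝ),
    ContDiff ℝ (⊤ : ℕ∞) S → ContDiff ℝ (⊤ : ℕ∞) (fun p : ℝ × AmbConfig d L n => St p.1 p.2) →
    IsFlowMap (fun t W => -linkGrad B (St t) W) Φ → (∀ t, Measurable (Φ t)) →
    (∀ t ∈ Set.Icc (0 : ℝ) 1, ∀ U : GaugeConfig d L SU[n],
      |luscherL B S t (St t) (WilsonFlow.coeConfig U) - S (WilsonFlow.coeConfig U) - c t| ≤ δ) →
    ∃ ρ : GaugeConfig d L SU[n] → ℝ, Measurable ρ ∧ (∀ U, 0 < ρ U) ∧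
      Measure.map (Φ 1) (trivialMeasure SU[n] d L) =
        (boltzmannMeasure fun U : GaugeConfig d L SU[n] => S (WilsonFlow.coeConfig U)).withDensity
          (fun U => ENNReal.ofReal (ρ U)) ∧
      ∀ U U', ρ U ≤ Real.exp (2 * δ) * ρ U'

/-! ## §4. Extensivity of the defect, uniformly in the volume (typed target) -/

/-- **Volume-uniform extensivity of the order-`N` defect density** (OURS, typed target, L-sized) for the
Wilson plaquette action in Lüscher's normalisation (`ambWilsonAction`, coupling `β = 1`; general `β`
multiplies the order-`N` defect by `β^{N+2}`, `IsLuscherSeries.smul`): there is `b_N`, INDEPENDENT OF `L`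
(and of the basis), with `sup_U |𝓥 S̃^{(N)}(U)| ≤ b_N · |E|` on every periodic lattice. Route: finite-order
locality (`LuscherSeriesLocal`; our sharper reading: range `≤ 1 + N`) + boundedness of loop functionals +
volume-independence of the loop coefficients (the recursion never sees `L` until a loop wraps).
[cite: Luscher2010Trivializing, §4.3 eqs. (4.14)–(4.15), §4.5(a)–(c)] -/
def ExtensiveDefect (d n N : ℕ) : Prop :=
  ∃ b : ℝ, ∀ (L : ℕ) [NeZero L] (B : SuBasis n) (Sk : ℕ → AmbConfig d L n → ℝ) (c : ℕ → ℝ),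
    (∀ k, ContDiff ℝ (⊤ : ℕ∞) (Sk k)) → IsLuscherSeries B ambWilsonAction Sk c →
    ∀ U : GaugeConfig d L SU[n],
      |luscherV B ambWilsonAction (Sk N) (WilsonFlow.coeConfig U)| ≤ b * Fintype.card (Edge d L)

/-- **Linear footprint growth** (OURS, the sharp form of `LuscherSeriesLocal` for the Wilson action, typed
target, M/L-sized): there is a smooth Lüscher series of `S_W` whose order-`k` term is a local sum of range
`1 + k` (anchoring each new term at the link where the plaquette is contracted; `Δ⁻¹` preserves the set of
links a smooth mean-zero functional depends on, because `Δ = ∑_e Δ_e` and `Δ_A = ∑_{e ∈ A} Δ_e` is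
invertible on mean-zero functions of the `A`-links). [folklore] -/
def LuscherFootprintLinear (d L n : ℕ) : Prop :=
  ∀ [NeZero L] (B : SuBasis n),
    ∃ (Sk : ℕ → AmbConfig d L n → ℝ) (c : ℕ → ℝ),
      IsLuscherSeries B ambWilsonAction Sk c ∧ (∀ k, ContDiff ℝ (⊤ : ℕ∞) (Sk k)) ∧
      ∀ k, IsLocalSum (1 + k) (Sk k)

/-! ## §5. Acceptance and ESS floors — MOVED to `Scaling/AcceptanceFloor.lean` (stated over the
definitions of record `Theory2.weight/essFrac`, `Exactness.accRate`): `accRate_ge_exp_neg`, `essFrac_ge_exp_neg`. -/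


/-! ## §6. The quantitative form of Lüscher's question (CONJECTURE item) and what it buys -/

/-- **Conjecture (ours; quantitative sharpening of `LuscherUniformRadius`, Lüscher 2010 §4.5(b)).** For the
Wilson action `S_W` on `SU(n)` in `d` dimensions there are `ρ > 0` and `C`, INDEPENDENT OF THE LATTICE SIZE,
such that every smooth Lüscher series `(s_k)` of `S_W` has link gradients bounded GEOMETRICALLY:
`|∂^a_{x,μ} s_k(U)| ≤ C ρ^{-k}` for all `k`, all links, colours, fields and all `L`. By `IsLuscherSeries.smul`
the series of `β S_W` then has `|∂ S̃^{(k)}| ≤ C β (β/ρ)^k`: the gradient series converges for `|t| β < ρ`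
UNIFORMLY IN `L` (so this implies `LuscherUniformRadius d n β` with `r = ρ/β`; the case `β = 1` is proved
below), and the order-`N` defect density of §4 obeys `b_N ≲ ρ^{-N}`. Cheapest falsifier: the exact low
orders in 2-d U(1) (THEORY-1.md §10) — growth of `max|∂ s_k|^{1/k}` there bounds `1/ρ` from below.
[cite: Luscher2010Trivializing, §4.5(b)] -/
-- STATUS: PROVED for all (d, n) — on paper THEORY-1 §12 Theorem A (2026-08-21, second-seat reviewed — PASS);
-- formally `GradedSeries.luscherGeometricGradientBound_holds (d n : ℕ) : LuscherGeometricGradientBound d n`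
-- (`TrivializingMaps/GradedTheoremA.lean`, p287466; corollaries `TrivializingMaps/TheoremA.lean`, p287885);
-- U(1) analogue kernel-checked (`TrivializingMaps/Abelian*.lean`).
@[conjecture]
def LuscherGeometricGradientBound (d n : ℕ) : Prop :=
  ∃ ρ : ℝ, 0 < ρ ∧ ∃ C : ℝ, ∀ (L : ℕ) [NeZero L] (B : SuBasis n)
    (Sk : ℕ → AmbConfig d L n → ℝ) (c : ℕ → ℝ),
    (∀ k, ContDiff ℝ (⊤ : ℕ∞) (Sk k)) → IsLuscherSeries B ambWilsonAction Sk c →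
    ∀ (k : ℕ) (U : GaugeConfig d L SU[n]) (e : Edge d L) (a : B.ι),
      |linkDeriv e (B.T a) (Sk k) (WilsonFlow.coeConfig U)| ≤ C * ρ⁻¹ ^ k

/-- The geometric gradient bound implies Lüscher's volume-uniform radius at `β = 1` (radius `≥ ρ`).
PROVED (comparison with a geometric series). [folklore] -/
theorem luscherUniformRadius_one_of_geometric (h : LuscherGeometricGradientBound d n) :
    LuscherUniformRadius d n 1 := by
  obtain ⟨ρ, hρ, C, hC⟩ := h
  refine ⟨ρ, hρ, fun L _ B Sk c hsm hser t ht U e a => ?_⟩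
  have hser' : IsLuscherSeries B ambWilsonAction Sk c := by
    simpa only [one_mul] using hser
  have hr : |t| * ρ⁻¹ < 1 := by
    rw [← div_eq_mul_inv, div_lt_one hρ]
    exact ht
  refine Summable.of_nonneg_of_le (fun k => by positivity) (fun k => ?_)
    ((summable_geometric_of_lt_one (by positivity) hr).mul_left C)
  calc |t| ^ k * |linkDeriv e (B.T a) (Sk k) (WilsonFlow.coeConfig U)|
      ≤ |t| ^ k * (C * ρ⁻¹ ^ k) := by
        gcongr
        exact hC L B Sk c hsm hser' k U e a
    _ = C * (|t| * ρ⁻¹) ^ k := by rw [mul_pow]; ring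

end

end Summit.Ventures.LatticeQCDFlow.TrivializingMaps
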